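import Summits.BirchSwinnertonDyer.BirchSwinnertonDyer.Theorems.SignedLowerHalvesSmallImageLowerHalfBothSignsRttTierUnitClosure
import Summits.BirchSwinnertonDyer.BirchSwinnertonDyer.Theorems.SignedLowerHalvesSmallImageLowerHalfBothSignsRttOneSidedCrux
import HarnessLib

/-!
# Route `SignedLowerHalves`, crux L `SmallImageLowerHalfBothSigns` (item stmt-BirchSwinnertonDyer-23599), line `rtt_w3`:
# the engine TIERED THREE WAYS — T1 (CM-curve partner, landed engine) · T1u (UNIT curve partner, landed engine) · T3 (the rest, ENG_T3)
# — and crux L BY NAME from print ∧ floor ∧ Kan₂ ∧ ENG_T3 (a v5 composition target offered to the LEAD)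

Width seat `bsd-line-slh-p3-w3` g13 under LEAD `cruxlead-stmt-BirchSwinnertonDyer-23599` g2 (cell `bsd-ssimc`); helper
`--supports stmt-BirchSwinnertonDyer-23599`; THEOREMS ONLY — no definition, no named fact, no `sorry`; a sorry-free SKELETON-SHAPED
composition, not a proof of crux L; nothing registered by this seat (the reshape is the LEAD's call); BSD is not proved by any of this.

WHAT CHANGES vs the LEAD's `…RttOneSidedCruxTiered` (p747833). There the research stub ENG_T2 is asked on every class pair WITHOUT a
CM-curve partner (57 of 136). The unit-curve engine (`partnerLayerLambdaLower_of_unitCurvePartner`, p750944) discharges ENG at every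
pair with a `p`-congruent curve `A` (good at `p`, `a_p(A) = 0`) whose `L(A,1)/Ω_A` is a non-zero `p`-adic unit — with NO main-conjecture
input — and Kan₂ runs at such a partner by its binder-free form (`thetaLayerLambda_of_partner`, p751654; Vatsal 1999 by name, `hV`).
So the engine can be asked ONLY on pairs with NEITHER partner type: `hENG3` = the ENG_T2 text + the extra hypothesis «no unit curve
partner». Everything else is the LEAD's §3/§4 verbatim (T1 branch, K0₂ branch, THEOREM B at `p = 3`, sign idleness at `p ≥ 5`).

* §1 `lamTransport_le_tiered3` — T1 (CM curve) / T1u (unit curve) / T3 (K0₂'s partner + `hENG3`).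
* §2 ★ `smallImageLowerHalfBothSigns_of_oneSignFloor_of_rtt_ge_tiered3` — crux L BY NAME from `hJ h12 h41 h5 h3 hD hC hS hmod hKim hPR hV`
  (all conjuncts of the v4 cite stub), `hfloor5` (= `stub_muOneSign_ns_ge5`), `hKan` (= Kan₂'s text, landed p747435) and `hENG3`.

References: [Kobayashi2003] Conjecture (p. 2), (3.6), Thm. 1.2, 4.1, 7.4; [BDKim2009] Cor. 2.13; [PollackRubin2004] Theorem (p. 448);
[Vatsal1999] (1.6), (1.13); [PollackWeston2011MT] §3.1, Thm. 4.1; [GreenbergVatsal2000] Prop. (2.4), §3 Rem. 3.4; [Pollack2003] Conj. 6.3.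
-/

set_option autoImplicit false
-- D-0017: single-problem summit, the namespace repeats the problem name by design.
set_option linter.dupNamespace false
noncomputable section

open scoped Classical MatrixGroups ModularForm BigOperators

open CongruenceSubgroup WeierstrassCurve Field Polynomial NumberField IsDedekindDomain
  Literature.NumberTheory.EllipticCurves Literature.NumberTheory.EllipticCurves.ModularForms
  Literature.NumberTheory.EllipticCurves.Rank1Residual
  Literature.NumberTheory.EllipticCurves.Kobayashi2003
  Literature.NumberTheory.EllipticCurves.GreenbergVatsal2000 ZpExtension
  Literature.NumberTheory.IwasawaTheory Rat.HeightOneSpectrum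
  Summit.BirchSwinnertonDyer.Rank1Residual.Supersingular
  Summit.BirchSwinnertonDyer.Rank1Residual.X1.MuLambda
  Summit.BirchSwinnertonDyer.Rank1Residual.X2.EulerFactorInvariants
  Summit.BirchSwinnertonDyer.BirchSwinnertonDyer.Theorems.SmallImageLambdaLowerThreeNsThetaTransport

namespace Summit.BirchSwinnertonDyer.BirchSwinnertonDyer.Theorems.SmallImageRttOneSided

/-! ## §1 The transport tiered three ways: T1 (CM curve) · T1u (unit curve) · T3 (ENG_T3) -/

section Tiered

/-- **The one-sided λ-transport on the small-image class from Kan₂ ∧ ENG_T3, TIERED THREE WAYS.** Granted by name: Kobayashi Thm 1.2 (`h12`),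
B. D. Kim 2009 Cor 2.13 (`hKim`), Pollack–Rubin 2004 (`hPR`), modularity (`hmod`), Deligne/Carayol/Saito (`hD hC hS`), the period units
(`h5 h3`), Vatsal 1999 (`hV`); the registered stub text Kan₂ (`hKan`) and ENG_T3 (`hENG3` = ENG asked only on pairs with NEITHER a
CM-curve partner NOR a unit curve partner). Then for every class pair `(W, p)` and sign `ε` the transport `λ(G) ≤ λ(X^ε_W)` holds: if a CM curve `A`
with `A[p] ≃ W[p]` exists (T1) the partner is `f_A` (§2) and ENG is the LANDED `partnerLayerLambdaLower_of_cmCurvePartner` (p745857);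
if a curve `A` good at `p` with `a_p(A) = 0`, `A[p] ≃ W[p]` and a unit `L`-value exists (T1u) the partner is `f_A`, ENG is the LANDED
`partnerLayerLambdaLower_of_unitCurvePartner` (p750944) and Kan₂ is `thetaLayerLambda_of_partner` (p751654); otherwise (T3) the partner is K0₂'s
(`stub_heckeThetaPartner_ns`, p741818, level clause p742955) and ENG is `hENG3`. CONDITIONAL; closes nothing. [cite: Kobayashi2003, (3.6)] [cite: BDKim2009, Cor. 2.13] [cite: PollackRubin2004, Theorem (p. 448)] [cite: PollackWeston2011MT, §3.1, Thm. 4.1 (1)] -/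
theorem lamTransport_le_tiered3
    (h12 : thm12_signedSelmerDual_finite_torsion)
    (hKim : BDKim2009.cor213_signedLambda_add_sum_delta_eq_of_torsionIso)
    (hPR : PollackRubin2004.mainTheorem_signedCharIdeal_eq_of_cm) (hmod : exists_isNewformOf)
    (hD : Hida2000_thm326_exists_galoisRep) (hC : Carayol1986_artinConductorExponent)
    (hS : ∀ (V : WeierstrassCurve ℚ) (ℓ : ℕ) [Fact ℓ.Prime],
      V.swanConductorAt_rationalTate_eq_wildConductorExponent_of_ringChar_eq_two ℓ)
    (h5 : realPeriodRat_eq_unit_mul_plusPeriod) (h3 : realPeriodRat_eq_unit_mul_plusPeriod_three)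
    (hV : vatsal1999_plusSymbol_congruence)
    (hKan : ∀ (W : WeierstrassCurve ℚ) [W.IsElliptic] [W.IsGloballyMinimal] (p : ℕ) [Fact p.Prime],
      p ≠ 2 → ClassX7 W p → ¬ W.HasCM → W.frobeniusTrace p = 0 → ¬ Surj W p →
      ∀ (ε : ℤˣ), ∀ (M : ℕ) [NeZero M] (g : CuspForm (Gamma0 M) 2) (ι : coeffField g →+* PadicAlgCl p) (Ω : ℂ),
        ¬ p ∣ M → (∀ ℓ : ℕ, ℓ.Prime → ℓ ≠ p → max 2 (padicValNat ℓ M) = max 2 (padicValNat ℓ (W.conductorNorm ℤ))) →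
        IsNewform0 g → Literature.NumberTheory.Automorphic.IsCMForm (liftToGamma1 M 2 g) →
        cuspCoeff g p = 0 → IsPlusPeriod g Ω →
        (∀ ℓ : ℕ, ℓ.Prime → ¬ ℓ ∣ p * M * W.conductorNorm ℤ →
          ‖embCoeff g ι ℓ - (W.frobeniusTrace ℓ : PadicAlgCl p)‖ < 1) →
        ∀ [NeZero (W.conductorNorm ℤ)] (f : CuspForm (Gamma0 (W.conductorNorm ℤ)) 2), IsNewformOf W f →
        ∀ (Lplus Lminus : IwasawaAlgebra p), IsPollackPair f p Lplus Lminus →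
          HasUnitContent (kobayashiL ε Lplus Lminus) →
        ∀ (S₀ : Finset (HeightOneSpectrum (𝓞 ℚ))), (∀ v ∈ S₀, ((p : ℕ) : 𝓞 ℚ) ∉ v.asIdeal) →
          (∀ v : HeightOneSpectrum (𝓞 ℚ), ¬ W.HasGoodReductionAt v → v ∈ S₀) →
          (∀ v : HeightOneSpectrum (𝓞 ℚ), natGenerator v ∣ M → v ∈ S₀) →
        ∃ n₀ : ℕ, ∀ n ≥ n₀, (Even n ↔ ε = 1) →
          layerLambda (((mazurTateElement f p n).map (algebraMap ℚ (PadicAlgCl p)) *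
              ∏ v ∈ S₀, ((W.localPolynomialAt v).map (Int.castRingHom (PadicAlgCl p))).comp
                (C ((natGenerator v : PadicAlgCl p)⁻¹) *
                  (X + 1) ^ (PadicInt.toZModPow n (-(frobeniusExponent p (natGenerator v : ℤ_[p])))).val)) %ₘ
              ((X + 1) ^ p ^ n - 1)) =
          layerLambda (((mazurTateElementK g Ω p n).map ι *
              ∏ v ∈ S₀, (1 - C (embCoeff g ι (natGenerator v)) * X +
                  (if natGenerator v ∣ M then 0 else C (natGenerator v : PadicAlgCl p)) * X ^ 2).comp
                (C ((natGenerator v : PadicAlgCl p)⁻¹) *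
                  (X + 1) ^ (PadicInt.toZModPow n (-(frobeniusExponent p (natGenerator v : ℤ_[p])))).val)) %ₘ
              ((X + 1) ^ p ^ n - 1)))
    (hENG3 : ∀ (W : WeierstrassCurve ℚ) [W.IsElliptic] [W.IsGloballyMinimal] (p : ℕ) [Fact p.Prime],
      p ≠ 2 → ClassX7 W p → ¬ W.HasCM → W.frobeniusTrace p = 0 → ¬ Surj W p →
      ¬ (∃ (A : WeierstrassCurve ℚ) (_ : A.IsElliptic) (_ : A.IsGloballyMinimal),
        A.HasCM ∧ GoodSS A p ∧ A.frobeniusTrace p = 0 ∧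
          ∃ e : geomTorsion W (p : ℤ) ≃+ geomTorsion A (p : ℤ),
            ∀ (σ : absoluteGaloisGroup ℚ) (P : geomTorsion W (p : ℤ)), e (σ • P) = σ • e P) →
      ¬ (∃ (A : WeierstrassCurve ℚ) (_ : A.IsElliptic) (_ : A.IsGloballyMinimal) (t : ℚ),
        A.HasGoodReductionAtPrime p ∧ A.frobeniusTrace p = 0 ∧
          (∃ e : geomTorsion W (p : ℤ) ≃+ geomTorsion A (p : ℤ),
            ∀ (σ : absoluteGaloisGroup ℚ) (P : geomTorsion W (p : ℤ)), e (σ • P) = σ • e P) ∧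
          A.entireLFunction 1 / (A.realPeriodRat : ℂ) = ((t : ℚ) : ℂ) ∧ t ≠ 0 ∧ padicValRat p t = 0) →
      ∀ (ε : ℤˣ), ∀ (M : ℕ) [NeZero M] (g : CuspForm (Gamma0 M) 2) (ι : coeffField g →+* PadicAlgCl p) (Ω : ℂ),
        ¬ p ∣ M → (∀ ℓ : ℕ, ℓ.Prime → ℓ ≠ p → max 2 (padicValNat ℓ M) = max 2 (padicValNat ℓ (W.conductorNorm ℤ))) →
        IsNewform0 g → Literature.NumberTheory.Automorphic.IsCMForm (liftToGamma1 M 2 g) →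
        cuspCoeff g p = 0 → IsCohomologicalPlusPeriod g ι Ω →
        (∀ ℓ : ℕ, ℓ.Prime → ¬ ℓ ∣ p * M * W.conductorNorm ℤ →
          ‖embCoeff g ι ℓ - (W.frobeniusTrace ℓ : PadicAlgCl p)‖ < 1) →
        ∀ (κ : ZpExtension ℚ p) (γ : absoluteGaloisGroup ℚ),
          κ.IsCyclotomic → κ.IsTopGenerator γ → IsCyclotomicVariable p γ →
        ∀ (S₀ : Finset (HeightOneSpectrum (𝓞 ℚ))), (∀ v ∈ S₀, ((p : ℕ) : 𝓞 ℚ) ∉ v.asIdeal) →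
          (∀ v : HeightOneSpectrum (𝓞 ℚ), ¬ W.HasGoodReductionAt v → v ∈ S₀) →
          (∀ v : HeightOneSpectrum (𝓞 ℚ), natGenerator v ∣ M → v ∈ S₀) →
        ∀ (D : SignedSelmerDualData W κ γ ε) [Module.Finite (IwasawaAlgebra p) D.X],
          Module.IsTorsion (IwasawaAlgebra p) D.X → D.mu = 0 →
        ∃ n₀ : ℕ, ∀ n ≥ n₀, (Even n ↔ ε = 1) →
          ((layerLambda (((mazurTateElementK g Ω p n).map ι *
              ∏ v ∈ S₀, (1 - C (embCoeff g ι (natGenerator v)) * X +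
                  (if natGenerator v ∣ M then 0 else C (natGenerator v : PadicAlgCl p)) * X ^ 2).comp
                (C ((natGenerator v : PadicAlgCl p)⁻¹) *
                  (X + 1) ^ (PadicInt.toZModPow n (-(frobeniusExponent p (natGenerator v : ℤ_[p])))).val)) %ₘ
              ((X + 1) ^ p ^ n - 1)) : ℕ) : ℤ) ≤
            ((if ε = 1 then cyclotomicOmegaMinus p n else cyclotomicOmegaPlus p n).natDegree : ℤ) +
              ((lambdaInvariant p D.X : ℕ) : ℤ) + ((∑ v ∈ S₀, delta W p v : ℕ) : ℤ))
    (W : WeierstrassCurve ℚ) [W.IsElliptic] [W.IsGloballyMinimal] (p : ℕ) [Fact p.Prime]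
    (hp : p ≠ 2) (hX : ClassX7 W p) (hcm : ¬ W.HasCM) (hap : W.frobeniusTrace p = 0) (hs : ¬ Surj W p) (ε : ℤˣ) :
    ∀ (κ : ZpExtension ℚ p) (γ : absoluteGaloisGroup ℚ),
      κ.IsCyclotomic → κ.IsTopGenerator γ → IsCyclotomicVariable p γ →
      ∀ [NeZero (W.conductorNorm ℤ)] (f : CuspForm (Gamma0 (W.conductorNorm ℤ)) 2),
        IsNewformOf W f → ∀ (ϖ : ℚ), (ϖ : ℝ) * W.realPeriodRat = plusPeriod f →
      ∀ (Lplus Lminus : IwasawaAlgebra p), IsPollackPair f p Lplus Lminus →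
        HasUnitContent (kobayashiL ε Lplus Lminus) →
      ∀ (D : SignedSelmerDualData W κ γ ε) [Module.Finite (IwasawaAlgebra p) D.X],
        Module.IsTorsion (IwasawaAlgebra p) D.X → D.mu = 0 →
      ∀ (G : IwasawaAlgebra p) (m : ℕ),
        iwasawaToPowerSeries p G =
          PowerSeries.C ((p : ℚ_[p]) ^ m * (ϖ : ℚ_[p])) * iwasawaToPowerSeries p (kobayashiL ε Lplus Lminus) →
        lam G ≤ lambdaInvariant p D.X := by
  have hgood : W.HasGoodReductionAtPrime p := hX.1.1
  by_cases hT1 : (∃ (A : WeierstrassCurve ℚ) (_ : A.IsElliptic) (_ : A.IsGloballyMinimal),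
        A.HasCM ∧ GoodSS A p ∧ A.frobeniusTrace p = 0 ∧
          ∃ e : geomTorsion W (p : ℤ) ≃+ geomTorsion A (p : ℤ),
            ∀ (σ : absoluteGaloisGroup ℚ) (P : geomTorsion W (p : ℤ)), e (σ • P) = σ • e P)
  · -- T1: the partner is `f_A`, ENG is the landed CM-curve engine
    obtain ⟨A, iA₁, iA₂, hcmA, hssA, hapA, he⟩ := hT1
    obtain ⟨iN, g, ι, Ω, hg, hpN, hlev, hnew, hcmg, hapg, hΩ, hcong, ⟨ϖA, hϖA⟩, hPol⟩ :=
      cmCurvePartner_supply hD hC hS hmod h5 h3 W A p hp hgood hcmA hssA hapA he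
    intro κ γ hκ hγ hγ' _ f hf ϖ hϖ Lplus Lminus hPP hfl D _ hXt hμ G m hG
    exact lamTransport_le_of_partner W p hp hgood ε g ι Ω hpN
      (hKan W p hp hX hcm hap hs ε (A.conductorNorm ℤ) g ι Ω hpN hlev hnew hcmg hapg hΩ.isPlusPeriod hcong)
      (fun κ γ hκ hγ hγ' S₀ hS₀p hS₀W hS₀A D _ hXt hμ ↦
        partnerLayerLambdaLower_of_cmCurvePartner h12 hKim hPR W A p hp hgood hap hcmA hssA hapA he g hg ι Ω
          hΩ.isPlusPeriod ϖA hϖA hPol ε κ γ hκ hγ hγ' S₀ hS₀p hS₀W hS₀A D hXt hμ)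
      κ γ hκ hγ hγ' f hf ϖ hϖ Lplus Lminus hPP hfl D hXt hμ G m hG
  by_cases hTu : (∃ (A : WeierstrassCurve ℚ) (_ : A.IsElliptic) (_ : A.IsGloballyMinimal) (t : ℚ),
        A.HasGoodReductionAtPrime p ∧ A.frobeniusTrace p = 0 ∧
          (∃ e : geomTorsion W (p : ℤ) ≃+ geomTorsion A (p : ℤ),
            ∀ (σ : absoluteGaloisGroup ℚ) (P : geomTorsion W (p : ℤ)), e (σ • P) = σ • e P) ∧
          A.entireLFunction 1 / (A.realPeriodRat : ℂ) = ((t : ℚ) : ℂ) ∧ t ≠ 0 ∧ padicValRat p t = 0)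
  · -- T1u: the partner is `f_A` for a unit curve `A`, ENG is the landed unit-curve engine, Kan₂ in binder-free form
    obtain ⟨A, iA₁, iA₂, t, hgoodA, hapA, he, ht, ht0, hvt⟩ := hTu
    exact lamTransport_le_of_unitCurvePartner W A p h12 h5 h3 hD hC hS hmod hKim hV hp hX hap hgoodA hapA he ht ht0 hvt ε
  · -- T3: the partner is K0₂'s, ENG is the stub ENG_T3
    obtain ⟨M, hM, g, ι, Ω, hpM, hnew, hcmg, hapg, hΩ, hcong⟩ :=
      Summit.BirchSwinnertonDyer.BirchSwinnertonDyer.Theorems.SmallImageLambdaLowerThreeNsThetaPartner.stub_heckeThetaPartner_ns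
        W p hp hX hcm hap hs
    haveI := hM
    have hlev : ∀ ℓ : ℕ, ℓ.Prime → ℓ ≠ p → max 2 (padicValNat ℓ M) = max 2 (padicValNat ℓ (W.conductorNorm ℤ)) :=
      Summit.BirchSwinnertonDyer.BirchSwinnertonDyer.Theorems.SmallImageLambdaLowerThreeNsThetaPartner.stub_levelMatch_ns hD hC hS
        W p hp hX hcm hap hs M g ι hpM hnew hcmg hcong
    intro κ γ hκ hγ hγ' _ f hf ϖ hϖ Lplus Lminus hPP hfl D _ hXt hμ G m hG
    exact lamTransport_le_of_partner W p hp hgood ε g ι Ω hpM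
      (hKan W p hp hX hcm hap hs ε M g ι Ω hpM hlev hnew hcmg hapg hΩ.isPlusPeriod hcong)
      (hENG3 W p hp hX hcm hap hs hT1 hTu ε M g ι Ω hpM hlev hnew hcmg hapg hΩ hcong)
      κ γ hκ hγ hγ' f hf ϖ hϖ Lplus Lminus hPP hfl D hXt hμ G m hG

end Tiered

/-! ## §2 CLASS-WIDE: crux L BY NAME from print ∧ (one-sign floor at `p ≥ 5`) ∧ Kan₂ ∧ ENG_T3 (a v5 composition target) -/

section ClassWide

/-- ★ **Crux L `SmallImageLowerHalfBothSigns` BY NAME ⟸ print ∧ (one-sign floor at `p ≥ 5` = `stub_muOneSign_ns_ge5` VERBATIM) ∧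
Kan₂ ∧ ENG_T3** — the LEAD's `smallImageLowerHalfBothSigns_of_oneSignFloor_of_rtt_ge_tiered` (p747833) with the engine tiered THREE ways
(§1): the CM-curve tranche T1 AND the unit-curve tranche T1u are discharged by landed engines, ENG is displayed only as ENG_T3. Displayed print: `hJ h12 h41 h5 h3` (Kobayashi, period units), `hD hC hS` (Deligne/Hida, Carayol, Saito@2), `hmod` (modularity),
`hKim` (B. D. Kim 2009 Cor 2.13), `hPR` (Pollack–Rubin 2004), `hV` (Vatsal 1999) — all conjuncts of the v4 cite stub; `hfloor5`, `hKan` = the v4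
stubs, `hENG3` = the proposed v5 engine stub.
`p = 3`: floor = THEOREM B (part 1′); `5 ≤ p`: sign idleness on X7. A sorry-free line-shaped decomposition; CONDITIONAL; closes nothing;
crux L / BSD NOT proved. [cite: Kobayashi2003, Conjecture (p. 2), Thm. 7.4 (p. 13)] [cite: Pollack2003, Conj. 6.3]
[cite: BDKim2009, Cor. 2.13] [cite: PollackRubin2004, Theorem (p. 448)] [cite: PollackWeston2011MT, §3.1, Thm. 4.1 (1)] -/
theorem smallImageLowerHalfBothSigns_of_oneSignFloor_of_rtt_ge_tiered3
    (hJ : thm62_63_73_signedColemanKato_zetaJoint) (h12 : thm12_signedSelmerDual_finite_torsion)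
    (h41 : thm41_signedCharIdeal_divisibility)
    (h5 : realPeriodRat_eq_unit_mul_plusPeriod) (h3 : realPeriodRat_eq_unit_mul_plusPeriod_three)
    (hD : Hida2000_thm326_exists_galoisRep) (hC : Carayol1986_artinConductorExponent)
    (hS : ∀ (V : WeierstrassCurve ℚ) (ℓ : ℕ) [Fact ℓ.Prime],
      V.swanConductorAt_rationalTate_eq_wildConductorExponent_of_ringChar_eq_two ℓ)
    (hmod : exists_isNewformOf)
    (hKim : BDKim2009.cor213_signedLambda_add_sum_delta_eq_of_torsionIso)
    (hPR : PollackRubin2004.mainTheorem_signedCharIdeal_eq_of_cm) (hV : vatsal1999_plusSymbol_congruence)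
    (hfloor5 : ∀ (W : WeierstrassCurve ℚ) [W.IsElliptic] [W.IsGloballyMinimal] (p : ℕ) [Fact p.Prime],
      5 ≤ p → ClassX7 W p → ¬ W.HasCM → W.frobeniusTrace p = 0 → ¬ Surj W p →
      ∀ [NeZero (W.conductorNorm ℤ)] (f : CuspForm (Gamma0 (W.conductorNorm ℤ)) 2),
        IsNewformOf W f → ∃ (ε₀ : ℤˣ) (L₀ : IwasawaAlgebra p), IsSignedPAdicLFunction f p ε₀ L₀ ∧ HasUnitContent L₀)
    (hKan : ∀ (W : WeierstrassCurve ℚ) [W.IsElliptic] [W.IsGloballyMinimal] (p : ℕ) [Fact p.Prime],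
      p ≠ 2 → ClassX7 W p → ¬ W.HasCM → W.frobeniusTrace p = 0 → ¬ Surj W p →
      ∀ (ε : ℤˣ), ∀ (M : ℕ) [NeZero M] (g : CuspForm (Gamma0 M) 2) (ι : coeffField g →+* PadicAlgCl p) (Ω : ℂ),
        ¬ p ∣ M → (∀ ℓ : ℕ, ℓ.Prime → ℓ ≠ p → max 2 (padicValNat ℓ M) = max 2 (padicValNat ℓ (W.conductorNorm ℤ))) →
        IsNewform0 g → Literature.NumberTheory.Automorphic.IsCMForm (liftToGamma1 M 2 g) →
        cuspCoeff g p = 0 → IsPlusPeriod g Ω →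
        (∀ ℓ : ℕ, ℓ.Prime → ¬ ℓ ∣ p * M * W.conductorNorm ℤ →
          ‖embCoeff g ι ℓ - (W.frobeniusTrace ℓ : PadicAlgCl p)‖ < 1) →
        ∀ [NeZero (W.conductorNorm ℤ)] (f : CuspForm (Gamma0 (W.conductorNorm ℤ)) 2), IsNewformOf W f →
        ∀ (Lplus Lminus : IwasawaAlgebra p), IsPollackPair f p Lplus Lminus →
          HasUnitContent (kobayashiL ε Lplus Lminus) →
        ∀ (S₀ : Finset (HeightOneSpectrum (𝓞 ℚ))), (∀ v ∈ S₀, ((p : ℕ) : 𝓞 ℚ) ∉ v.asIdeal) →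
          (∀ v : HeightOneSpectrum (𝓞 ℚ), ¬ W.HasGoodReductionAt v → v ∈ S₀) →
          (∀ v : HeightOneSpectrum (𝓞 ℚ), natGenerator v ∣ M → v ∈ S₀) →
        ∃ n₀ : ℕ, ∀ n ≥ n₀, (Even n ↔ ε = 1) →
          layerLambda (((mazurTateElement f p n).map (algebraMap ℚ (PadicAlgCl p)) *
              ∏ v ∈ S₀, ((W.localPolynomialAt v).map (Int.castRingHom (PadicAlgCl p))).comp
                (C ((natGenerator v : PadicAlgCl p)⁻¹) *
                  (X + 1) ^ (PadicInt.toZModPow n (-(frobeniusExponent p (natGenerator v : ℤ_[p])))).val)) %ₘ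
              ((X + 1) ^ p ^ n - 1)) =
          layerLambda (((mazurTateElementK g Ω p n).map ι *
              ∏ v ∈ S₀, (1 - C (embCoeff g ι (natGenerator v)) * X +
                  (if natGenerator v ∣ M then 0 else C (natGenerator v : PadicAlgCl p)) * X ^ 2).comp
                (C ((natGenerator v : PadicAlgCl p)⁻¹) *
                  (X + 1) ^ (PadicInt.toZModPow n (-(frobeniusExponent p (natGenerator v : ℤ_[p])))).val)) %ₘ
              ((X + 1) ^ p ^ n - 1)))
    (hENG3 : ∀ (W : WeierstrassCurve ℚ) [W.IsElliptic] [W.IsGloballyMinimal] (p : ℕ) [Fact p.Prime],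
      p ≠ 2 → ClassX7 W p → ¬ W.HasCM → W.frobeniusTrace p = 0 → ¬ Surj W p →
      ¬ (∃ (A : WeierstrassCurve ℚ) (_ : A.IsElliptic) (_ : A.IsGloballyMinimal),
        A.HasCM ∧ GoodSS A p ∧ A.frobeniusTrace p = 0 ∧
          ∃ e : geomTorsion W (p : ℤ) ≃+ geomTorsion A (p : ℤ),
            ∀ (σ : absoluteGaloisGroup ℚ) (P : geomTorsion W (p : ℤ)), e (σ • P) = σ • e P) →
      ¬ (∃ (A : WeierstrassCurve ℚ) (_ : A.IsElliptic) (_ : A.IsGloballyMinimal) (t : ℚ),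
        A.HasGoodReductionAtPrime p ∧ A.frobeniusTrace p = 0 ∧
          (∃ e : geomTorsion W (p : ℤ) ≃+ geomTorsion A (p : ℤ),
            ∀ (σ : absoluteGaloisGroup ℚ) (P : geomTorsion W (p : ℤ)), e (σ • P) = σ • e P) ∧
          A.entireLFunction 1 / (A.realPeriodRat : ℂ) = ((t : ℚ) : ℂ) ∧ t ≠ 0 ∧ padicValRat p t = 0) →
      ∀ (ε : ℤˣ), ∀ (M : ℕ) [NeZero M] (g : CuspForm (Gamma0 M) 2) (ι : coeffField g →+* PadicAlgCl p) (Ω : ℂ),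
        ¬ p ∣ M → (∀ ℓ : ℕ, ℓ.Prime → ℓ ≠ p → max 2 (padicValNat ℓ M) = max 2 (padicValNat ℓ (W.conductorNorm ℤ))) →
        IsNewform0 g → Literature.NumberTheory.Automorphic.IsCMForm (liftToGamma1 M 2 g) →
        cuspCoeff g p = 0 → IsCohomologicalPlusPeriod g ι Ω →
        (∀ ℓ : ℕ, ℓ.Prime → ¬ ℓ ∣ p * M * W.conductorNorm ℤ →
          ‖embCoeff g ι ℓ - (W.frobeniusTrace ℓ : PadicAlgCl p)‖ < 1) →
        ∀ (κ : ZpExtension ℚ p) (γ : absoluteGaloisGroup ℚ),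
          κ.IsCyclotomic → κ.IsTopGenerator γ → IsCyclotomicVariable p γ →
        ∀ (S₀ : Finset (HeightOneSpectrum (𝓞 ℚ))), (∀ v ∈ S₀, ((p : ℕ) : 𝓞 ℚ) ∉ v.asIdeal) →
          (∀ v : HeightOneSpectrum (𝓞 ℚ), ¬ W.HasGoodReductionAt v → v ∈ S₀) →
          (∀ v : HeightOneSpectrum (𝓞 ℚ), natGenerator v ∣ M → v ∈ S₀) →
        ∀ (D : SignedSelmerDualData W κ γ ε) [Module.Finite (IwasawaAlgebra p) D.X],
          Module.IsTorsion (IwasawaAlgebra p) D.X → D.mu = 0 →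
        ∃ n₀ : ℕ, ∀ n ≥ n₀, (Even n ↔ ε = 1) →
          ((layerLambda (((mazurTateElementK g Ω p n).map ι *
              ∏ v ∈ S₀, (1 - C (embCoeff g ι (natGenerator v)) * X +
                  (if natGenerator v ∣ M then 0 else C (natGenerator v : PadicAlgCl p)) * X ^ 2).comp
                (C ((natGenerator v : PadicAlgCl p)⁻¹) *
                  (X + 1) ^ (PadicInt.toZModPow n (-(frobeniusExponent p (natGenerator v : ℤ_[p])))).val)) %ₘ
              ((X + 1) ^ p ^ n - 1)) : ℕ) : ℤ) ≤
            ((if ε = 1 then cyclotomicOmegaMinus p n else cyclotomicOmegaPlus p n).natDegree : ℤ) +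
              ((lambdaInvariant p D.X : ℕ) : ℤ) + ((∑ v ∈ S₀, delta W p v : ℕ) : ℤ)) :
    Summit.BirchSwinnertonDyer.BirchSwinnertonDyer.Theses.SignedLowerHalves.SmallImageLowerHalfBothSigns := by
  intro W _ _ p _ hp2 hX hCM hap hs ε
  have hT := lamTransport_le_tiered3 h12 hKim hPR hmod hD hC hS h5 h3 hV hKan hENG3 W p hp2 hX hCM hap hs
  by_cases hp3 : p = 3
  · exact forall_kobayashiLowerDivisibility_three_of_lamTransport_le W p hp3 hJ h12 h41 h5 h3 hX hap hs
      (fun ε' κ γ hκ hγ hγ' _ f hf ϖ hϖ Lplus Lminus hPP hfl D _ hXt hμ G m hG ↦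
        hT ε' κ γ hκ hγ hγ' f hf ϖ hϖ Lplus Lminus hPP hfl D hXt hμ G m hG) ε
  · have hp5 : 5 ≤ p := by
      have h2 := (Fact.out : p.Prime).two_le
      by_contra h
      interval_cases p
      · exact hp2 rfl
      · exact hp3 rfl
      · exact absurd (Fact.out : Nat.Prime 4) (by decide)
    obtain ⟨ε₀, hε₀⟩ := LargeImageMuFloor.exists_sign_forall_isNewformOf (W := W)
      (fun ε f ↦ ∃ L₀ : IwasawaAlgebra p, IsSignedPAdicLFunction f p ε L₀ ∧ HasUnitContent L₀)
      (fun f hf ↦ hfloor5 W p hp5 hX hCM hap hs f hf)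
    have hfl : ∀ [NeZero (W.conductorNorm ℤ)] (f : CuspForm (Gamma0 (W.conductorNorm ℤ)) 2), IsNewformOf W f →
        ∀ Lplus Lminus : IwasawaAlgebra p, IsPollackPair f p Lplus Lminus →
          HasUnitContent (kobayashiL ε₀ Lplus Lminus) := by
      intro _ f hf Lplus Lminus hPP
      obtain ⟨L₀, hL₀, hu⟩ := hε₀ f hf
      rwa [IsSignedPAdicLFunction.unique hL₀ (hPP.isSignedPAdicLFunction_kobayashiL ε₀)] at hu
    have hMC : KobayashiMainConjecture W p ε₀ :=
      kobayashiMainConjecture_of_lamTransport_le W p hp2 (thm62_63_73_signedColemanKato_zeta_of_joint hJ) h12 h41 h5 h3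
        hX.1.1 hap hs ε₀ (fun f hf Lplus Lminus hPP ↦ hfl f hf Lplus Lminus hPP)
        (fun κ γ hκ hγ hγ' _ f hf ϖ hϖ Lplus Lminus hPP D _ hXt hμ G m hG ↦
          hT ε₀ κ γ hκ hγ hγ' f hf ϖ hϖ Lplus Lminus hPP (hfl f hf Lplus Lminus hPP) D hXt hμ G m hG)
    exact (SignDefect.X7.exists_kobayashiLowerDivisibility_iff_forall W p h12 h5 h3 hJ hp2 hX hap).mp
      ⟨ε₀, kobayashiLowerDivisibility_of_mainConjecture hMC⟩ ε

end ClassWide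

end Summit.BirchSwinnertonDyer.BirchSwinnertonDyer.Theorems.SmallImageRttOneSided

end
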